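import Literature.MathematicalPhysics.QuantumFieldTheory.Balaban1983to89.B14Eq316
import Literature.MathematicalPhysics.QuantumFieldTheory.Balaban1983to89.B14Eq123Localization
import Literature.MathematicalPhysics.QuantumFieldTheory.Balaban1983to89.B14Sect3Decomp

/-!
# `Balaban1983to89.B14Eq321Concrete` — CMP 119 (3.21) p. 269 with `χ′_k(S_{k+1})` CONCRETE (the (3.3)-function in the
# integral (3.15), bond by bond), and the sentence *"These changes of variables transform the function χ′_k(S_{k+1}) into
# the same function, but with V^{(k)} replaced by V^{(k)}_{Λᶜ_{k+1}∩Λ_k}. … The other characteristic functions are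
# unchanged"* PROVED from (3.22) and p28's (1.23)-lemmas at step `k`

statement-level skeleton of published theorems with citation tags; proofs where landed; nothing here is a claim
about the Yang–Mills mass gap.

CITATION HEADER (lean-in-tree rule).  Source: T. Bałaban, *Convergent renormalization expansions for lattice gauge
theories*, Commun. Math. Phys. **119**, 243–285 (1988), doi:10.1007/bf01217741 [Balaban1988Convergent] (cell paper
B14 = "[III]"; held `paper:balaban1988-cmp119-convergent-renormalization`, journal page = PDF page + 242; pp. 265–269
read on the text layer p0023–p0027 and the x2 renders `…-p023-x2.png` … `…-p027-x2.png`).  Mega-formalization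
`lit-balaban`, unit `lit-balaban-r11` (CMP 119, B14 fold owner), SKELETON row **B14.Eq3.21–3.22** — the owed member named
by the owner's READING-RULE audit (`READING-RULE-AUDIT-B14-g96.md` §4: *"(3.21) `chi321` takes χ′_k(S_{k+1}) as an ABSTRACT
family … Owed: χ′_k concrete on the (1.23) pattern (p28's `B14Eq123Localization` at step k)"*).

THE PRINTED TEXT (verbatim).  p. 265 [PDF 23], (3.3): *"1 = Σ_{Q_{k+1}} Π_{□′⊂Qᶜ_{k+1}} χ({sup_{b∈(□′^{∼2})^{(k)*}}
|V_k(b)(V^{(k)}_{□′}(b))⁻¹ − 1| < 2δ_k}) · Π_{□′⊂Q_{k+1}} χ({… ≧ 2δ_k}) = Σ_{Q_{k+1}} χ′_k(Qᶜ_{k+1})χ′ᶜ_k(Q_{k+1})"*;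
p. 266 (3.11): *"The fluctuation field V′_k is defined now by V′_k = V_k(V^{(k)})⁻¹"*; p. 267: *"We define
A_k = (1/i) log V′_k … and we perform the scaling transformation A_k = g_kA_k"*; p. 269 [PDF 27]: *"On the domain
Ω_{k+1}∩Λᶜ_{k+1} there is the function
  χ(Ω_{k+1}∩Λᶜ_{k+1}, S_{k+1}) = χ^{(k)}(Rᶜ_{k+1}∩Λᶜ_{k+1}) χ^{(k)c}(R_{k+1}) χ′_k(S_{k+1}).   (3.21)
The last function above depends nonlocally on V_{k+1}, through the function V^{(k)}. … Denoting
  V^{(k)}(V^{(k)}_{Λᶜ_{k+1}∩Λ_k})⁻¹ = exp i𝐇^{(k)},   (3.22)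
… Now we make a change of variables for each bond variable A_k(b), b ∈ S^{(k)*}_{k+1}. For bonds in
(R^{∼2}_{k+1}∩S_{k+1})^{(k)*} we take the change of variables given by the formula (1.22), with 𝐇^{(k)}(b) instead of
𝐇_{1,Ax}(b). For the remaining bonds we take the simpler change of variables with the function g(A_k(b)) replaced by 1.
These changes of variables transform the function χ′_k(S_{k+1}) into the same function, but with V^{(k)} replaced by
V^{(k)}_{Λᶜ_{k+1}∩Λ_k}. We use the same notation for the new function. The other characteristic functions are
unchanged."*

THE MODEL (that of the sibling files `B14Eq316` (3.16)/(3.21)/(3.22), `B14ChangeOfVariables` (1.22) and p28's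
`B14Eq123Localization` (1.23)): bond variables in a complete normed `ℂ`-algebra `𝔸` (print: `G ⊂ U(n) ⊂ M_n(ℂ)`, `𝐠 ⊂ M_n(ℂ)`);
`ι` = the L²M₂R_{k+1}-cubes `□′`, `β` = the bonds of `T^{(k)}`, `bonds □′` = `(□′^{∼2})^{(k)*}`; a configuration is the
(scaled) fluctuation field `A : β → 𝔸`, so that `V_k(b) = exp(ig_kA_k(b))V^{(k)}(b)` ((3.11) with p. 267's `A_k =
(1/i) log V′_k`, `A_k = g_kA_k`); the argument of (3.3) is then `exp(ig_kA(b))·U(b)`, `U(b) = V^{(k)}(b)(V^{(k)}_{□′}(b))⁻¹`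
— LITERALLY p28's letters `(g₀, A′, U, W, H) ↦ (g_k, A, V^{(k)}(V^{(k)}_{□′})⁻¹, V^{(k)}_{Λᶜ∩Λ_k}(V^{(k)}_{□′})⁻¹, 𝐇^{(k)})`,
and (3.22) exponentiated is p28's (1.21)-form hypothesis `U = exp(iH)·W` (`u322_of_bH`, from `B14.Eq316.exp_I_smul_bH`).

WHAT IS PROVED (0 sorry; definitions WITH BODIES `SmallApproxFluctA`, `chiPrimeA`, `chi321A`, `newField`).
§1 `χ′_k` CONCRETE at a fluctuation configuration: `SmallApproxFluctA bonds g twoδ U A □′ : ∀ b ∈ bonds □′,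
   ‖exp(igA(b))·U □′ b − 1‖ < 2δ`, `chiPrimeA … X A = Π_{□′∈X} χ(…)` (value 0/1, `chiPrimeA_eq_one_iff`), and **(3.21) with all
   three factors concrete**: `chi321A bonds δ g twoδ U RcΛc R S := B14.Eq316.chi321 bonds δ id (chiPrimeA bonds g twoδ U) RcΛc R S`
   (`chi321A_apply`).  DICTIONARY with the decl of record of (3.3) on the `Setup` carrier (r11 gen 2
   `B14.Sect3Decomp.chiPrime`, `dist1`-form): under the (3.11)/(3.13) identification `|V_k(b)(V^{(k)}_{□′}(b))⁻¹ − 1| =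
   ‖exp(ig_kA(b))·U □′ b − 1‖` the two functions coincide (`chiPrime_eq_chiPrimeA`).
§2 (3.22) in p28's (1.21)-form: with `H := B14.Eq316.bH (V^{(k)} b) (V^{(k)}_{Λᶜ∩Λ_k} b)`,
   `V^{(k)}(b)·X = exp(iH)·(V^{(k)}_{Λᶜ∩Λ_k}(b)·X)` for any right factor `X` (here `(V^{(k)}_{□′}(b))⁻¹`) on `‖V^{(k)}V_{ΛΛ}⁻¹ − 1‖ < 1`
   (`u322_of_bH`).
§3 The changed field: `newField Sstar g gsel H A′ b := if b ∈ Sstar then newVar g (gsel b) (H b) (A′ b) else A′ b` — the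
   change of variables (1.22)/(3.22) on the bonds of `S^{(k)*}_{k+1}` with a per-bond cut-off `gsel b` (print: the cut-off `g`
   on `(R^{∼2}∩S)^{(k)*}`, `g ≡ 1` on the remaining bonds of `S*`), the identity elsewhere.
§4 **"transform the function χ′_k(S_{k+1}) into the same function, but with V^{(k)} replaced by V^{(k)}_{Λᶜ_{k+1}∩Λ_k}"**:
   bond by bond (`smallArg_newVar_iff`: cut-off bonds by p28's `secondFactor_iff`, `g ≡ 1` bonds by `oldArg_eq_of_cutoff_one`),
   per cube (`smallApproxFluctA_newField_iff`) and for the whole function (`chiPrimeA_newField`): for cube families `S`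
   whose bond sets lie in the changed set, `χ′_k(S)(A_new; U = V^{(k)}V_□⁻¹) = χ′_k(S)(A′; W = V_{ΛΛ}V_□⁻¹)` — EXACT, under
   print's smallness inputs in p28's explicit form (`‖W − 1‖ ≤ δ/100`, `‖𝐇^{(k)}‖ ≤ δ/100` on cut-off bonds — p. 268
   «much smaller than δ_k», (3.18)/(3.19); the log-domain condition `hZ`).
§5 **"The other characteristic functions are unchanged"**: the large-field factor `χ^{(k)c}(R_{k+1})` on cut-off bonds
   (`chiKc_newField_of_cutoff`, p28's `firstFactor_iff`, threshold `g⁻¹δ` as in (1.18)), and ANY `chiK`/`chiKc` of cubes whose bonds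
   are not changed (`chiK_newField_of_disjoint`, `chiKc_newField_of_disjoint`); hence (3.21) after the change = (3.21) at `A′`
   with `W` (`chi321A_newField`).
HONEST SCOPE.  Located readings: (i) the bonds of a cube `□′ ⊂ S_{k+1}` entering `χ′_k(□′)` are assumed to lie in the changed
set `S^{(k)*}_{k+1}` (hypothesis `hS`) and those of `Rᶜ∩Λᶜ`-cubes to avoid it (`hdisj`) — print's bond bookkeeping behind
"the same function"/"unchanged", not displayed; (ii) the thresholds `δ` ((3.16)) and `2δ` ((3.3)) and the first-factor
threshold `g⁻¹δ₀` of p28 are parameters; (iii) the smallness of `𝐇^{(k)}` and of `W − 1` are HYPOTHESES here — their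
derivations are rows B14.Eq3.21–3.22 ((190)-knit files `B14Eq322From190`, `B14From190*`) and B14.Eq3.16–3.19; (iv) nothing
about the Jacobian/action terms `V^{(k)}(S_{k+1}, A_k, 𝐇^{(k)})` (row B14.Eq1.23–1.25's (1.24) pattern, p28
`B14Eq124Jacobians`).  No structure, no named fact, no `sorry`.
-/

noncomputable section

namespace Literature.MathematicalPhysics.QuantumFieldTheory.Balaban1983to89.B14.Eq321Concrete

open NormedSpace
open Literature.MathematicalPhysics.QuantumFieldTheory.Balaban1983to89 B14.Eq316 B14.ChangeOfVariables
  B14Eq123Localization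

variable {ι β : Type*} {𝔸 : Type*} [NormedRing 𝔸] [NormedAlgebra ℂ 𝔸]

/-! ## §1  `χ′_k` concrete at a fluctuation configuration, and (3.21) with all three factors concrete -/

/-- The small approximate-fluctuation condition of (3.3) for one cube `□′` in the integral (3.15), i.e. after (3.11),
p. 267's `A_k = (1/i) log V′_k` and the scaling `A_k = g_kA_k`: `sup_{b∈(□′^{∼2})^{(k)*}} |exp(ig_kA_k(b)) U(b) − 1| < 2δ_k`
with `U □′ b = V^{(k)}(b)(V^{(k)}_{□′}(b))⁻¹`, typed bondwise. [cite: Balaban1988Convergent, (3.3) p.265, (3.21) p.269] -/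
def SmallApproxFluctA (bonds : ι → Finset β) (g twoδ : ℝ) (U : ι → β → 𝔸) (A : β → 𝔸) (c : ι) : Prop :=
  ∀ b ∈ bonds c, ‖exp (((Complex.I : ℂ) * (g : ℂ)) • A b) * U c b - 1‖ < twoδ

/-- Decidability of the small approximate-fluctuation condition (classical), for the `0/1` products below. [folklore] -/
instance instDecidableSmallApproxFluctA (bonds : ι → Finset β) (g twoδ : ℝ) (U : ι → β → 𝔸) (A : β → 𝔸) (c : ι) :
    Decidable (SmallApproxFluctA bonds g twoδ U A c) :=
  Classical.dec _

/-- **`χ′_k(X)` concrete**: `Π_{□′∈X} χ({sup_{b∈(□′^{∼2})^{(k)*}} |exp(ig_kA_k(b))V^{(k)}(b)(V^{(k)}_{□′}(b))⁻¹ − 1| < 2δ_k})`, the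
(3.3)-function of the cube family `X` as a function of the fluctuation field. [cite: Balaban1988Convergent, (3.3) p.265, (3.21) p.269] -/
def chiPrimeA (bonds : ι → Finset β) (g twoδ : ℝ) (U : ι → β → 𝔸) (X : Finset ι) (A : β → 𝔸) : ℝ :=
  ∏ c ∈ X, if SmallApproxFluctA bonds g twoδ U A c then (1 : ℝ) else 0

/-- `χ′_k(X) = 1` iff every cube of `X` satisfies the small approximate-fluctuation condition (a `0/1` function).
[cite: Balaban1988Convergent, (3.3) p.265] -/
theorem chiPrimeA_eq_one_iff (bonds : ι → Finset β) (g twoδ : ℝ) (U : ι → β → 𝔸) (X : Finset ι) (A : β → 𝔸) :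
    chiPrimeA bonds g twoδ U X A = 1 ↔ ∀ c ∈ X, SmallApproxFluctA bonds g twoδ U A c := by
  unfold chiPrimeA
  constructor
  · intro h c hc
    by_contra hn
    have : (∏ c ∈ X, if SmallApproxFluctA bonds g twoδ U A c then (1 : ℝ) else 0) = 0 :=
      Finset.prod_eq_zero hc (by simp [hn])
    rw [this] at h; exact zero_ne_one h
  · intro h
    exact Finset.prod_eq_one fun c hc => by simp [h c hc]

/-- `χ′_k(X)` depends on the configuration only through the cube conditions: two configurations with the same small/large
status on every cube of `X` give the same value. [cite: Balaban1988Convergent, (3.3) p.265] -/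
theorem chiPrimeA_congr {bonds : ι → Finset β} {g twoδ : ℝ} {U U' : ι → β → 𝔸} {X : Finset ι} {A A' : β → 𝔸}
    (h : ∀ c ∈ X, (SmallApproxFluctA bonds g twoδ U A c ↔ SmallApproxFluctA bonds g twoδ U' A' c)) :
    chiPrimeA bonds g twoδ U X A = chiPrimeA bonds g twoδ U' X A' := by
  unfold chiPrimeA
  exact Finset.prod_congr rfl fun c hc => by simp only [h c hc]

/-- **(3.21) with all three factors concrete**: `χ(Ω_{k+1}∩Λᶜ_{k+1}, S_{k+1})(A) = χ^{(k)}(Rᶜ∩Λᶜ)(A)·χ^{(k)c}(R)(A)·χ′_k(S)(A)` —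
r11 gen 2's `B14.Eq316.chi321` with the configuration = the fluctuation field itself (`fluct := id`) and
`chi' := chiPrimeA bonds g 2δ U`. [cite: Balaban1988Convergent, (3.21) p.269] -/
def chi321A (bonds : ι → Finset β) (δ g twoδ : ℝ) (U : ι → β → 𝔸) (RcΛc R S : Finset ι) : (β → 𝔸) → ℝ :=
  chi321 bonds δ (fun A : β → 𝔸 => A) (fun X A => chiPrimeA bonds g twoδ U X A) RcΛc R S

/-- Unfolding of the concrete (3.21). [cite: Balaban1988Convergent, (3.21) p.269] -/
theorem chi321A_apply (bonds : ι → Finset β) (δ g twoδ : ℝ) (U : ι → β → 𝔸) (RcΛc R S : Finset ι) (A : β → 𝔸) :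
    chi321A bonds δ g twoδ U RcΛc R S A
      = chiK bonds A δ RcΛc * chiKc bonds A δ R * chiPrimeA bonds g twoδ U S A := rfl

/-- **DICTIONARY with the decl of record of (3.3)** (`B14.Sect3Decomp.chiPrime` on the `Setup` carrier, `dist1`-form): if the
`Setup` quantities `|V_k(b)(V^{(k)}_{□′}(b))⁻¹ − 1|` ARE the model quantities `‖exp(ig_kA(b))·U □′ b − 1‖` on the starred
bonds — the reading (3.11) + p. 267 (`V_k = exp(ig_kA_k)V^{(k)}`, `dist1 = ‖· − 1‖` in a matrix realisation) — then
`χ′_k(X)` of record equals `chiPrimeA`. [cite: Balaban1988Convergent, (3.3) p.265, (3.11) p.266] -/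
theorem chiPrime_eq_chiPrimeA {P : Params} {G : Type*} [GaugeGroup G] {k : ℕ} (D : B14.Sect3Decomp.Sect3Data P G k)
    (av : ∀ j, Averaging P j G) (twoδ : ℝ) (X : Finset D.Cube1) (Vk : GaugeField P k G)
    (V : GaugeField P (k + 1) G) (g : ℝ) (U : D.Cube1 → PBond P k → 𝔸) (A : PBond P k → 𝔸)
    (hident : ∀ c ∈ X, ∀ b ∈ D.bondsStar c,
      GaugeGroup.dist1 (Vk b * (B14.Sect3Decomp.Vbox D av c V b)⁻¹)
        = ‖exp (((Complex.I : ℂ) * (g : ℂ)) • A b) * U c b - 1‖) :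
    B14.Sect3Decomp.chiPrime D av twoδ X Vk V = chiPrimeA D.bondsStar g twoδ U X A := by
  classical
  unfold B14.Sect3Decomp.chiPrime chiPrimeA
  refine Finset.prod_congr rfl fun c hc => ?_
  have hiff : B14.Sect3Decomp.SmallApproxFluct D av twoδ Vk V c ↔ SmallApproxFluctA D.bondsStar g twoδ U A c := by
    unfold B14.Sect3Decomp.SmallApproxFluct SmallApproxFluctA
    exact forall₂_congr fun b hb => by rw [hident c hc b hb]
  simp only [hiff]

/-! ## §2  (3.22) exponentiated, in p28's (1.21)-form `U = exp(iH)·W` -/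

section U322

variable [CompleteSpace 𝔸]

/-- **(3.22) as the (1.21)-form hypothesis of p28's lemmas**: with `𝐇^{(k)}(b) = bH (V^{(k)} b) (V_{ΛΛ} b)`
(`V_{ΛΛ} = V^{(k)}_{Λᶜ_{k+1}∩Λ_k}`) and any right factor `X` (here `(V^{(k)}_{□′}(b))⁻¹`):
`V^{(k)}(b)·X = exp(i𝐇^{(k)}(b))·(V_{ΛΛ}(b)·X)` on `‖V^{(k)}(b)V_{ΛΛ}(b)⁻¹ − 1‖ < 1` (r11 gen 2's `exp_I_smul_bH`).
[cite: Balaban1988Convergent, (3.22) p.269] -/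
theorem u322_of_bH (Vk VΛ : 𝔸ˣ) (X : 𝔸) (h : ‖((Vk * VΛ⁻¹ : 𝔸ˣ) : 𝔸) - 1‖ < 1) :
    (Vk : 𝔸) * X = exp ((Complex.I : ℂ) • bH Vk VΛ) * ((VΛ : 𝔸) * X) := by
  rw [exp_I_smul_bH Vk VΛ h, ← mul_assoc, Units.val_mul, Units.inv_mul_cancel_right]

end U322

/-! ## §3  The changed field on `S^{(k)*}_{k+1}` -/

/-- **The change of variables of p. 269** as a map on configurations: on the bonds of `Sstar = S^{(k)*}_{k+1}` the new
variable is `(1.22)` with `𝐇^{(k)}(b)` and the per-bond cut-off `gsel b` (print: the cut-off `g` on `(R^{∼2}∩S)^{(k)*}`, the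
constant `1` on the remaining bonds of `S*`); the other bond variables are untouched. `newField … A′` is the OLD variable
`A` expressed through the NEW one `A′` (the direction of (1.22)). [cite: Balaban1988Convergent, (3.22) p.269, (1.22) p.251] -/
def newField [DecidableEq β] (Sstar : Finset β) (g : ℝ) (gsel : β → 𝔸 → ℝ) (H A' : β → 𝔸) : β → 𝔸 :=
  fun b => if b ∈ Sstar then newVar g (gsel b) (H b) (A' b) else A' b

/-- On a changed bond the field is the (1.22)-variable. [cite: Balaban1988Convergent, (3.22) p.269] -/
theorem newField_of_mem [DecidableEq β] {Sstar : Finset β} (g : ℝ) (gsel : β → 𝔸 → ℝ) (H A' : β → 𝔸) {b : β}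
    (hb : b ∈ Sstar) : newField Sstar g gsel H A' b = newVar g (gsel b) (H b) (A' b) := by
  simp [newField, hb]

/-- Off the changed set the field is untouched. [cite: Balaban1988Convergent, (3.22) p.269] -/
theorem newField_of_not_mem [DecidableEq β] {Sstar : Finset β} (g : ℝ) (gsel : β → 𝔸 → ℝ) (H A' : β → 𝔸) {b : β}
    (hb : b ∉ Sstar) : newField Sstar g gsel H A' b = A' b := by
  simp [newField, hb]

/-! ### "The other characteristic functions are unchanged", part 1: cubes whose bonds are untouched -/

section Untouched

variable [DecidableEq β]

/-- The (3.16) small-field condition of a cube whose bonds are NOT changed is literally the same for the changed field.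
[cite: Balaban1988Convergent, (3.16) p.268, (3.22) p.269] -/
theorem smallFluct_newField_of_disjoint {bonds : ι → Finset β} {Sstar : Finset β} (g : ℝ) (gsel : β → 𝔸 → ℝ)
    (H A' : β → 𝔸) (δ' : ℝ) {c : ι} (hc : Disjoint (bonds c) Sstar) :
    SmallFluct bonds (newField Sstar g gsel H A') δ' c ↔ SmallFluct bonds A' δ' c := by
  unfold SmallFluct
  refine forall₂_congr fun b hb => ?_
  rw [newField_of_not_mem g gsel H A' (Finset.disjoint_left.1 hc hb)]

/-- `χ^{(k)}(X)` is unchanged when no bond of a cube of `X` is changed (the cubes of `Rᶜ_{k+1}∩Λᶜ_{k+1}` away from `S_{k+1}`).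
[cite: Balaban1988Convergent, (3.16) p.268, (3.21)–(3.22) p.269] -/
theorem chiK_newField_of_disjoint {bonds : ι → Finset β} {Sstar : Finset β} (g : ℝ) (gsel : β → 𝔸 → ℝ)
    (H A' : β → 𝔸) (δ' : ℝ) {X : Finset ι} (hX : ∀ c ∈ X, Disjoint (bonds c) Sstar) :
    chiK bonds (newField Sstar g gsel H A') δ' X = chiK bonds A' δ' X := by
  unfold chiK
  exact Finset.prod_congr rfl fun c hc => by simp only [smallFluct_newField_of_disjoint g gsel H A' δ' (hX c hc)]

/-- `χ^{(k)c}(X)` is unchanged when no bond of a cube of `X` is changed. [cite: Balaban1988Convergent, (3.16) p.268, (3.22) p.269] -/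
theorem chiKc_newField_of_disjoint {bonds : ι → Finset β} {Sstar : Finset β} (g : ℝ) (gsel : β → 𝔸 → ℝ)
    (H A' : β → 𝔸) (δ' : ℝ) {X : Finset ι} (hX : ∀ c ∈ X, Disjoint (bonds c) Sstar) :
    chiKc bonds (newField Sstar g gsel H A') δ' X = chiKc bonds A' δ' X := by
  unfold chiKc
  exact Finset.prod_congr rfl fun c hc => by simp only [smallFluct_newField_of_disjoint g gsel H A' δ' (hX c hc)]

end Untouched

/-! ## §4  "transform the function χ′_k(S_{k+1}) into the same function, but with V^{(k)} replaced by V^{(k)}_{Λᶜ∩Λ_k}" -/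

section Transform

variable [CompleteSpace 𝔸]

/-- **One bond**: the (3.3)-argument in the new variable with `U = exp(iH)·W` ((3.22)) versus the old-shaped argument with `W`
in place of `U`: `‖exp(igA_new)·U − 1‖ < 2δ ↔ ‖exp(igA′)·W − 1‖ < 2δ` — on a cut-off bond by p28's `secondFactor_iff`
(`IsCutoff g δ`, `‖W − 1‖, ‖H‖ ≤ δ/100`), on a `g ≡ 1` bond because the two arguments COINCIDE
(`oldArg_eq_of_cutoff_one`). [cite: Balaban1988Convergent, (3.22) p.269, (1.23) p.252] -/
theorem smallArg_newVar_iff {g δ : ℝ} (hg0 : g ≠ 0) (hδ : 0 < δ) (hδ1 : δ ≤ 1) {gb : 𝔸 → ℝ}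
    (hgb : IsCutoff g δ gb ∨ gb = fun _ => 1) {H A' U W : 𝔸} (hU : U = exp ((Complex.I : ℂ) • H) * W)
    (hW : ‖W - 1‖ ≤ δ / 100) (hH : ‖H‖ ≤ δ / 100)
    (hZ : ‖exp (((Complex.I : ℂ) * (g : ℂ)) • A') * exp (-(((Complex.I : ℂ) * ((gb A' : ℝ) : ℂ)) • H)) - 1‖ < 1) :
    ‖exp (((Complex.I : ℂ) * (g : ℂ)) • newVar g gb H A') * U - 1‖ < 2 * δ
      ↔ ‖exp (((Complex.I : ℂ) * (g : ℂ)) • A') * W - 1‖ < 2 * δ := by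
  rcases hgb with hcut | hone
  · exact secondFactor_iff hg0 hδ hδ1 hcut hU hW hH hZ
  · have hg1 : gb A' = 1 := by rw [hone]
    rw [oldArg_eq_of_cutoff_one hg0 hg1 hU hZ]

variable [DecidableEq β]

/-- **One cube of `S_{k+1}`**: if all bonds of `□′` lie in the changed set, the small approximate-fluctuation condition of
`□′` for the changed field and `U = V^{(k)}V_□⁻¹` is that of the new variable `A′` and `W = V_{ΛΛ}V_□⁻¹`.
[cite: Balaban1988Convergent, (3.21)–(3.22) p.269] -/
theorem smallApproxFluctA_newField_iff {bonds : ι → Finset β} {Sstar : Finset β} {g δ : ℝ} (hg0 : g ≠ 0)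
    (hδ : 0 < δ) (hδ1 : δ ≤ 1) {gsel : β → 𝔸 → ℝ} (hgsel : ∀ b ∈ Sstar, IsCutoff g δ (gsel b) ∨ gsel b = fun _ => 1)
    {H A' : β → 𝔸} {U W : ι → β → 𝔸} {c : ι} (hc : bonds c ⊆ Sstar)
    (hU : ∀ b ∈ bonds c, U c b = exp ((Complex.I : ℂ) • H b) * W c b)
    (hW : ∀ b ∈ bonds c, ‖W c b - 1‖ ≤ δ / 100) (hH : ∀ b ∈ bonds c, ‖H b‖ ≤ δ / 100)
    (hZ : ∀ b ∈ bonds c, ‖exp (((Complex.I : ℂ) * (g : ℂ)) • A' b)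
      * exp (-(((Complex.I : ℂ) * ((gsel b (A' b) : ℝ) : ℂ)) • H b)) - 1‖ < 1) :
    SmallApproxFluctA bonds g (2 * δ) U (newField Sstar g gsel H A') c
      ↔ SmallApproxFluctA bonds g (2 * δ) W A' c := by
  unfold SmallApproxFluctA
  refine forall₂_congr fun b hb => ?_
  rw [newField_of_mem g gsel H A' (hc hb)]
  exact smallArg_newVar_iff hg0 hδ hδ1 (hgsel b (hc hb)) (hU b hb) (hW b hb) (hH b hb) (hZ b hb)

/-- **"These changes of variables transform the function χ′_k(S_{k+1}) into the same function, but with V^{(k)} replaced by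
V^{(k)}_{Λᶜ_{k+1}∩Λ_k}"** — EXACTLY, for a cube family `S` whose bond sets lie in the changed set `S^{(k)*}_{k+1}`:
`χ′_k(S)(A_old = newField … A′ ; U = V^{(k)}V_□⁻¹) = χ′_k(S)(A′ ; W = V_{ΛΛ}V_□⁻¹)`, under (3.22) in the form `U = exp(i𝐇)W`
and print's smallness of `𝐇^{(k)}` and `W − 1` (p28's explicit constants). [cite: Balaban1988Convergent, (3.21)–(3.22) p.269] -/
theorem chiPrimeA_newField {bonds : ι → Finset β} {Sstar : Finset β} {g δ : ℝ} (hg0 : g ≠ 0) (hδ : 0 < δ)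
    (hδ1 : δ ≤ 1) {gsel : β → 𝔸 → ℝ} (hgsel : ∀ b ∈ Sstar, IsCutoff g δ (gsel b) ∨ gsel b = fun _ => 1)
    {H A' : β → 𝔸} {U W : ι → β → 𝔸} {S : Finset ι} (hS : ∀ c ∈ S, bonds c ⊆ Sstar)
    (hU : ∀ c ∈ S, ∀ b ∈ bonds c, U c b = exp ((Complex.I : ℂ) • H b) * W c b)
    (hW : ∀ c ∈ S, ∀ b ∈ bonds c, ‖W c b - 1‖ ≤ δ / 100) (hH : ∀ c ∈ S, ∀ b ∈ bonds c, ‖H b‖ ≤ δ / 100)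
    (hZ : ∀ c ∈ S, ∀ b ∈ bonds c, ‖exp (((Complex.I : ℂ) * (g : ℂ)) • A' b)
      * exp (-(((Complex.I : ℂ) * ((gsel b (A' b) : ℝ) : ℂ)) • H b)) - 1‖ < 1) :
    chiPrimeA bonds g (2 * δ) U S (newField Sstar g gsel H A') = chiPrimeA bonds g (2 * δ) W S A' :=
  chiPrimeA_congr fun c hc =>
    smallApproxFluctA_newField_iff hg0 hδ hδ1 hgsel (hS c hc) (hU c hc) (hW c hc) (hH c hc) (hZ c hc)

/-! ## §5  "The other characteristic functions are unchanged", part 2: the large-field factor on cut-off bonds; (3.21) after the change -/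

/-- **The large-field factor `χ^{(k)c}(R_{k+1})` is unchanged on the CUT-OFF bonds** (threshold `g⁻¹δ` of (1.18)/(3.16)
after scaling): for a cube all of whose bonds are changed with the cut-off `g`, `¬(sup ‖A_old‖ < g⁻¹δ) ↔ ¬(sup ‖A′‖ < g⁻¹δ)`
— p28's `firstFactor_iff` bond by bond (smallness `‖gA′‖, ‖H‖ ≤ 1/10`, `‖H‖ ≤ δ/4`).
[cite: Balaban1988Convergent, (3.16) p.268, (1.23) p.252] -/
theorem smallFluct_newField_iff_of_cutoff {bonds : ι → Finset β} {Sstar : Finset β} {g δ : ℝ} (hg0 : 0 < g)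
    (hδ : 0 ≤ δ) {gsel : β → 𝔸 → ℝ} {H A' : β → 𝔸} {c : ι} (hc : bonds c ⊆ Sstar)
    (hcut : ∀ b ∈ bonds c, IsCutoff g δ (gsel b)) (hA : ∀ b ∈ bonds c, ‖(g : ℂ) • A' b‖ ≤ 1 / 10)
    (hH : ∀ b ∈ bonds c, ‖H b‖ ≤ 1 / 10) (hHδ : ∀ b ∈ bonds c, ‖H b‖ ≤ δ / 4) :
    SmallFluct bonds (newField Sstar g gsel H A') (g⁻¹ * δ) c ↔ SmallFluct bonds A' (g⁻¹ * δ) c := by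
  unfold SmallFluct
  refine forall₂_congr fun b hb => ?_
  rw [newField_of_mem g gsel H A' (hc hb)]
  have h := firstFactor_iff hg0 hδ (hcut b hb) (hA b hb) (hH b hb) (hHδ b hb)
  constructor
  · intro hlt; by_contra hle; exact absurd (h.2 (not_lt.1 hle)) (not_le.2 hlt)
  · intro hlt; by_contra hle; exact absurd (h.1 (not_lt.1 hle)) (not_le.2 hlt)

/-- Hence `χ^{(k)c}(R_{k+1})(A_old) = χ^{(k)c}(R_{k+1})(A′)` for the cube family `R` on the cut-off bonds `(R^{∼2}∩S)^{(k)*}`.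
[cite: Balaban1988Convergent, (3.16) p.268, (3.21)–(3.22) p.269] -/
theorem chiKc_newField_of_cutoff {bonds : ι → Finset β} {Sstar : Finset β} {g δ : ℝ} (hg0 : 0 < g) (hδ : 0 ≤ δ)
    {gsel : β → 𝔸 → ℝ} {H A' : β → 𝔸} {R : Finset ι} (hR : ∀ c ∈ R, bonds c ⊆ Sstar)
    (hcut : ∀ c ∈ R, ∀ b ∈ bonds c, IsCutoff g δ (gsel b)) (hA : ∀ c ∈ R, ∀ b ∈ bonds c, ‖(g : ℂ) • A' b‖ ≤ 1 / 10)
    (hH : ∀ c ∈ R, ∀ b ∈ bonds c, ‖H b‖ ≤ 1 / 10) (hHδ : ∀ c ∈ R, ∀ b ∈ bonds c, ‖H b‖ ≤ δ / 4) :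
    chiKc bonds (newField Sstar g gsel H A') (g⁻¹ * δ) R = chiKc bonds A' (g⁻¹ * δ) R := by
  unfold chiKc
  exact Finset.prod_congr rfl fun c hc => by
    simp only [smallFluct_newField_iff_of_cutoff hg0 hδ (hR c hc) (hcut c hc) (hA c hc) (hH c hc) (hHδ c hc)]

/-- **(3.21) after the change of variables** (p. 269, the two sentences together): with `χ^{(k)}` on cubes whose bonds are
untouched, `χ^{(k)c}` on cut-off bonds and `χ′_k` on changed bonds,
`χ(Ω∩Λᶜ, S)(A_old; U) = χ^{(k)}(Rᶜ∩Λᶜ)(A′)·χ^{(k)c}(R)(A′)·χ′_k(S)(A′; W)` — the same function of the new variable with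
`V^{(k)}` replaced by `V^{(k)}_{Λᶜ∩Λ_k}` in `χ′_k`. [cite: Balaban1988Convergent, (3.21)–(3.22) p.269] -/
theorem chi321A_newField {bonds : ι → Finset β} {Sstar : Finset β} {g δ δ' : ℝ} (hg0 : 0 < g) (hδ' : 0 ≤ δ')
    (hδ : 0 < δ) (hδ1 : δ ≤ 1) {gsel : β → 𝔸 → ℝ} (hgsel : ∀ b ∈ Sstar, IsCutoff g δ (gsel b) ∨ gsel b = fun _ => 1)
    {H A' : β → 𝔸} {U W : ι → β → 𝔸} {RcΛc R S : Finset ι}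
    (hdisj : ∀ c ∈ RcΛc, Disjoint (bonds c) Sstar)
    (hR : ∀ c ∈ R, bonds c ⊆ Sstar) (hcut : ∀ c ∈ R, ∀ b ∈ bonds c, IsCutoff g δ' (gsel b))
    (hA : ∀ c ∈ R, ∀ b ∈ bonds c, ‖(g : ℂ) • A' b‖ ≤ 1 / 10) (hHR : ∀ c ∈ R, ∀ b ∈ bonds c, ‖H b‖ ≤ 1 / 10)
    (hHδR : ∀ c ∈ R, ∀ b ∈ bonds c, ‖H b‖ ≤ δ' / 4)
    (hS : ∀ c ∈ S, bonds c ⊆ Sstar)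
    (hU : ∀ c ∈ S, ∀ b ∈ bonds c, U c b = exp ((Complex.I : ℂ) • H b) * W c b)
    (hW : ∀ c ∈ S, ∀ b ∈ bonds c, ‖W c b - 1‖ ≤ δ / 100) (hH : ∀ c ∈ S, ∀ b ∈ bonds c, ‖H b‖ ≤ δ / 100)
    (hZ : ∀ c ∈ S, ∀ b ∈ bonds c, ‖exp (((Complex.I : ℂ) * (g : ℂ)) • A' b)
      * exp (-(((Complex.I : ℂ) * ((gsel b (A' b) : ℝ) : ℂ)) • H b)) - 1‖ < 1) :
    chi321A bonds (g⁻¹ * δ') g (2 * δ) U RcΛc R S (newField Sstar g gsel H A')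
      = chiK bonds A' (g⁻¹ * δ') RcΛc * chiKc bonds A' (g⁻¹ * δ') R * chiPrimeA bonds g (2 * δ) W S A' := by
  rw [chi321A_apply, chiK_newField_of_disjoint g gsel H A' _ hdisj,
    chiKc_newField_of_cutoff hg0 hδ' hR hcut hA hHR hHδR, chiPrimeA_newField hg0.ne' hδ hδ1 hgsel hS hU hW hH hZ]

end Transform

end Literature.MathematicalPhysics.QuantumFieldTheory.Balaban1983to89.B14.Eq321Concrete
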